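import Summits.CriticalPhenomena.PercolationContinuityZ3.Theorems.PercNearOneGluingNoHeavyQuantFarTreeBlockCombSide
import Summits.CriticalPhenomena.PercolationContinuityZ3.Theorems.PercNearOneGluingNoHeavyQuantBlockCombHairRow
import HarnessLib

/-!
# QUANT lane R8, FAR on trees beyond block-combs: the TWO-RELAY HAIR row in gate coordinates (`Quant.BlockCombGate.farTree_blockComb_hair`)

builds on p205010 (kernel theorem, internal audit signed; external expert review pending)

Support file (`--supports stmt-CriticalPhenomena-4575`), QUANT lane typer seat prim-quant-stmt (gen 16); census-1 g13's transport ask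
(lane INBOX 2026-08-21T05:12Z (ii)).  Theorems only (the `local notation3` of `…QuantBlockCombMergeModel.lean`, verbatim), no definitions,
no sorries, standard axioms.  Tools: the mixing identity `Quant.BlockCombGate.real_heavy_side_eq_sum` (`…QuantFarTreeBlockCombSide.lean`,
same seat) and census-1 g13's canonical hair row `Quant.BlockComb.tail_ge_of_mean_hair` (`…QuantBlockCombHairRow.lean`, p248279: mixture
principle on top of the block-comb row p247138).

* `Quant.BlockComb.tail_ge_of_mean_hair_le` — the hair row with the floor relaxed from `x = ∏_{i<D} q i` to `0 < x ≤ ∏_{i<D} q i`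
  (append the virtual gate `x / ∏ q` below every blob, `tail_append_gate`).
* `Quant.BlockCombGate.real_heavy_hair_eq` — the hair (`X = {e₁, e₂}`: a unit relay on gate `e₁` at chain level `lv u`, a unit relay on
  gate `e₂` below it): `P(heavy) = (1 − p)·T₀ + p(1 − r)·T₁ + p r·T₂`, `p = q e₁`, `r = q e₂`, `T_h = TAIL[…, a[u ↦ h], …]` — the
  right-hand side of `Quant.BlockComb.tail_ge_of_mean_hair`.
* `Quant.BlockCombGate.farTree_blockComb_hair` — **FAR AT EVERY LAYER FOR BLOCK-COMB + ONE TWO-RELAY HAIR, gate coordinates**: mean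
  hypothesis `2j < Σ_k a k·marginal k + (∏_{i<l} q (ch i))·(p + p r)`, cuts `1 − marginal ≤ t` for every live blob and for the hair's
  lower relay, chain floor `1 − ∏_{i<D} q (ch i) ≤ t` ⟹ `P(#relays reached ≤ j) ≤ t`.
Route vocabulary (`Quant.FarRelayRow` body for tree-supported weights): companion file `…QuantFarRelayRowBlockCombHair.lean`.
[cite: KozmaNitzan2024, Conjecture 3 (p. 15)] (the gluing rows served); the family theorems are [this work].
-/

noncomputable section

namespace Summit.CriticalPhenomena.PercolationContinuityZ3.Theorems

namespace Quant

open Finset MeasureTheory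
open Literature.Probability.LatticeModels
open Literature.Probability.Percolation
open scoped Classical

namespace BlockComb

variable {κ : Type*} [Fintype κ] [DecidableEq κ]

/-- product-Bernoulli weight of the set `S` of open blob gates -/
local notation3 "wt[" g ", " S "]" => ∏ k, (if k ∈ (S : Finset κ) then (g : κ → ℝ) k else 1 - (g : κ → ℝ) k)
/-- probability that the chain `q` of length `D` is open exactly to depth `i` -/
local notation3 "pd[" D ", " q ", " i "]" =>
  (∏ i' ∈ Finset.range (i : ℕ), (q : ℕ → ℝ) i') * (if (i : ℕ) < (D : ℕ) then 1 - (q : ℕ → ℝ) i else 1)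
/-- mass counted at depth `i` in blob configuration `S` -/
local notation3 "mass[" lv ", " a ", " i ", " S "]" =>
  ∑ k ∈ (S : Finset κ).filter (fun k => (lv : κ → ℕ) k ≤ (i : ℕ)), ((a : κ → ℕ) k : ℕ)
/-- the tail `P(N ≥ j+1)` of the block-comb count, as an explicit finite sum -/
local notation3 "TAIL[" D ", " q ", " lv ", " a ", " g ", " j "]" =>
  ∑ i ∈ Finset.range ((D : ℕ) + 1), pd[D, q, i] *
    ∑ S : Finset κ, wt[g, S] * (if (j : ℕ) + 1 ≤ mass[lv, a, i, S] then (1 : ℝ) else 0)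

/-! ### 0. The hair row with a relaxed floor -/

/-- **The two-relay hair row, floor `0 < x ≤ ∏_{i<D} q i`** (census-1's `tail_ge_of_mean_hair` has `x = ∏ q`; append the virtual chain
gate `x / ∏ q` below every blob — the three tails do not see it, `tail_append_gate`). [this work] -/
theorem tail_ge_of_mean_hair_le (D : ℕ) (q : ℕ → ℝ) (hq : ∀ i, 0 ≤ q i ∧ q i ≤ 1) (lv : κ → ℕ) (a : κ → ℕ)
    (g : κ → ℝ) (hg : ∀ k, 0 ≤ g k ∧ g k ≤ 1) (j : ℕ) (hlv : ∀ k, 0 < a k → lv k ≤ D)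
    (u β : κ) (huβ : u ≠ β) (hlu : lv u ≤ D) (hlβ : lv β = lv u) (hau : a u = 0) (haβ : a β = 0)
    (p r : ℝ) (hp : 0 ≤ p ∧ p ≤ 1) (hr : 0 ≤ r ∧ r ≤ 1)
    (x : ℝ) (hx0 : 0 < x) (hxle : x ≤ ∏ i ∈ Finset.range D, q i)
    (hmarg : ∀ k, 0 < a k → x ≤ (∏ i ∈ Finset.range (lv k), q i) * g k)
    (hhair : x ≤ (∏ i ∈ Finset.range (lv u), q i) * (p * r))
    (hbudget : (2 * j : ℝ) < ∑ k, (a k : ℝ) * ((∏ i ∈ Finset.range (lv k), q i) * g k) +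
      (∏ i ∈ Finset.range (lv u), q i) * (p + p * r)) :
    x ≤ (1 - p) * TAIL[D, q, lv, a, Function.update g u 1, j] +
        p * (1 - r) * TAIL[D, q, lv, Function.update a u 1, Function.update g u 1, j] +
        p * r * TAIL[D, q, lv, Function.update a u 2, Function.update g u 1, j] := by
  set P : ℝ := ∏ i ∈ Finset.range D, q i with hP
  have hP0 : 0 < P := hx0.trans_le hxle
  set q' : ℕ → ℝ := Function.update q D (x / P) with hq'def
  have hq' : ∀ i, 0 ≤ q' i ∧ q' i ≤ 1 := by
    intro i
    by_cases hi : i = D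
    · subst hi
      rw [hq'def, Function.update_self]
      exact ⟨div_nonneg hx0.le hP0.le, (div_le_one hP0).2 hxle⟩
    · rw [hq'def, Function.update_of_ne hi]; exact hq i
  have hpre : ∀ i, i ≤ D → ∏ i' ∈ Finset.range i, q' i' = ∏ i' ∈ Finset.range i, q i' := by
    intro i hi
    refine Finset.prod_congr rfl fun i' hi' => ?_
    have hne : i' ≠ D := by have := Finset.mem_range.1 hi'; omega
    rw [hq'def, Function.update_of_ne hne]
  have hxq' : x = ∏ i ∈ Finset.range (D + 1), q' i := by
    rw [Finset.prod_range_succ, hpre D le_rfl, hq'def, Function.update_self, ← hP]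
    field_simp
  have hmarg' : ∀ k, 0 < a k → x ≤ (∏ i ∈ Finset.range (lv k), q' i) * g k := by
    intro k hk
    rw [hpre (lv k) (hlv k hk)]
    exact hmarg k hk
  have hhair' : x ≤ (∏ i ∈ Finset.range (lv u), q' i) * (p * r) := by rw [hpre (lv u) hlu]; exact hhair
  have hbudget' : (2 * j : ℝ) < ∑ k, (a k : ℝ) * ((∏ i ∈ Finset.range (lv k), q' i) * g k) +
      (∏ i ∈ Finset.range (lv u), q' i) * (p + p * r) := by
    rw [hpre (lv u) hlu]
    refine hbudget.trans_le (le_of_eq ?_)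
    congr 1
    refine Finset.sum_congr rfl fun k _ => ?_
    by_cases hk : 0 < a k
    · rw [hpre (lv k) (hlv k hk)]
    · have : a k = 0 := by omega
      rw [this]; simp
  have h := tail_ge_of_mean_hair (D + 1) q' hq' lv a g hg j (fun k hk => (hlv k hk).trans (Nat.le_succ D)) u β huβ
    (hlu.trans (Nat.le_succ D)) hlβ hau haβ p r hp hr x hx0 hxq' hmarg' hhair' hbudget'
  -- the three tails do not see the appended gate
  have hlv1 : ∀ k, 0 < Function.update a u 1 k → lv k ≤ D := by
    intro k hk
    by_cases hku : k = u
    · rw [hku]; exact hlu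
    · rw [Function.update_of_ne hku] at hk; exact hlv k hk
  have hlv2 : ∀ k, 0 < Function.update a u 2 k → lv k ≤ D := by
    intro k hk
    by_cases hku : k = u
    · rw [hku]; exact hlu
    · rw [Function.update_of_ne hku] at hk; exact hlv k hk
  rw [hq'def, tail_append_gate D q lv a (Function.update g u 1) j (x / P) hlv,
    tail_append_gate D q lv (Function.update a u 1) (Function.update g u 1) j (x / P) hlv1,
    tail_append_gate D q lv (Function.update a u 2) (Function.update g u 1) j (x / P) hlv2] at h
  exact h

end BlockComb

namespace BlockCombGate

variable {E : Type*} [Fintype E] [DecidableEq E] {κ : Type*} [Fintype κ] [DecidableEq κ]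

/-- product weight of a set of open blobs (canonical model of `…QuantBlockCombMergeModel`) -/
local notation3 "wt[" g ", " S "]" => ∏ k, (if k ∈ (S : Finset κ) then (g : κ → ℝ) k else 1 - (g : κ → ℝ) k)
/-- depth law of the chain -/
local notation3 "pd[" D ", " q ", " i "]" =>
  (∏ i' ∈ Finset.range (i : ℕ), (q : ℕ → ℝ) i') * (if (i : ℕ) < (D : ℕ) then 1 - (q : ℕ → ℝ) i else 1)
/-- mass counted at depth `i` -/
local notation3 "mass[" lv ", " a ", " i ", " S "]" =>
  ∑ k ∈ (S : Finset κ).filter (fun k => (lv : κ → ℕ) k ≤ (i : ℕ)), ((a : κ → ℕ) k : ℕ)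
/-- the canonical tail -/
local notation3 "TAIL[" D ", " q ", " lv ", " a ", " g ", " j "]" =>
  ∑ i ∈ Finset.range ((D : ℕ) + 1), pd[D, q, i] *
    ∑ S : Finset κ, wt[g, S] * (if (j : ℕ) + 1 ≤ mass[lv, a, i, S] then (1 : ℝ) else 0)

/-! ### 1. The two-relay hair -/

/-- **The hair identification.**  Side structure `X = {e₁, e₂}` (a unit relay on gate `e₁` at chain level `lv u`, a unit relay on gate
`e₂` below it): `P(Σ_{k reached} a k + [prefix, e₁ open] + [prefix, e₁, e₂ open] ≥ j+1) = (1 − p)·T₀ + p(1 − r)·T₁ + p r·T₂` with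
`p = q e₁`, `r = q e₂`, `T_h = TAIL[D, q ∘ ch, lv, a[u ↦ h], ∏_{G ·} q, j]` — the right-hand side of `Quant.BlockComb.tail_ge_of_mean_hair`.
[this work] -/
theorem real_heavy_hair_eq (D : ℕ) (q : E → unitInterval) (ch : Fin D → E) (hch : Function.Injective ch)
    (G : κ → Finset E) (hGdisj : ∀ k k', k ≠ k' → Disjoint (G k) (G k')) (hGch : ∀ k (i : Fin D), ch i ∉ G k)
    (lv : κ → ℕ) (hlv : ∀ k, lv k ≤ D) (a : κ → ℕ) (j : ℕ) (u : κ) (hGu : G u = ∅) (hau : a u = 0)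
    (e₁ e₂ : E) (he : e₁ ≠ e₂) (hch₁ : ∀ i : Fin D, ch i ≠ e₁) (hch₂ : ∀ i : Fin D, ch i ≠ e₂)
    (hG₁ : ∀ k, e₁ ∉ G k) (hG₂ : ∀ k, e₂ ∉ G k) :
    (prodBernoulli q).real {ω : Set E | j + 1 ≤ (∑ k ∈ Finset.univ.filter
        (fun k => (∀ i : Fin D, (i : ℕ) < lv k → ch i ∈ ω) ∧ ((G k : Finset E) : Set E) ⊆ ω), a k) +
        (if (∀ i : Fin D, (i : ℕ) < lv u → ch i ∈ ω) then
          ((if e₁ ∈ ω then 1 else 0) + (if e₁ ∈ ω ∧ e₂ ∈ ω then 1 else 0)) else 0)} =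
      (1 - (q e₁ : ℝ)) * TAIL[D, (fun i => if h : i < D then ((q (ch ⟨i, h⟩) : unitInterval) : ℝ) else 1), lv, a,
          (fun k => ∏ e ∈ G k, (q e : ℝ)), j] +
        (q e₁ : ℝ) * (1 - (q e₂ : ℝ)) * TAIL[D, (fun i => if h : i < D then ((q (ch ⟨i, h⟩) : unitInterval) : ℝ) else 1),
          lv, Function.update a u 1, (fun k => ∏ e ∈ G k, (q e : ℝ)), j] +
        (q e₁ : ℝ) * (q e₂ : ℝ) * TAIL[D, (fun i => if h : i < D then ((q (ch ⟨i, h⟩) : unitInterval) : ℝ) else 1),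
          lv, Function.update a u 2, (fun k => ∏ e ∈ G k, (q e : ℝ)), j] := by
  -- the side structure `X = {e₁, e₂}` (written `insert e₁ (insert e₂ ∅)` for the powerset computation)
  have he₂' : e₂ ∉ (∅ : Finset E) := Finset.notMem_empty e₂
  have he₁' : e₁ ∉ insert e₂ (∅ : Finset E) := by
    rw [Finset.mem_insert, not_or]; exact ⟨he, Finset.notMem_empty e₁⟩
  have hX1 : ∀ i : Fin D, ch i ∉ insert e₁ (insert e₂ (∅ : Finset E)) := by
    intro i
    rw [Finset.mem_insert, Finset.mem_insert, not_or, not_or]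
    exact ⟨hch₁ i, hch₂ i, Finset.notMem_empty _⟩
  have hX2 : ∀ k, Disjoint (insert e₁ (insert e₂ (∅ : Finset E))) (G k) := by
    intro k
    rw [Finset.disjoint_insert_left, Finset.disjoint_insert_left]
    exact ⟨hG₁ k, hG₂ k, Finset.disjoint_empty_left _⟩
  have hc : ∀ ω ω' : Set E, (∀ x ∈ insert e₁ (insert e₂ (∅ : Finset E)), (x ∈ ω ↔ x ∈ ω')) →
      ((if e₁ ∈ ω then 1 else 0) + (if e₁ ∈ ω ∧ e₂ ∈ ω then 1 else 0) : ℕ) =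
        (if e₁ ∈ ω' then 1 else 0) + (if e₁ ∈ ω' ∧ e₂ ∈ ω' then 1 else 0) := by
    intro ω ω' h
    have h1 := h e₁ (Finset.mem_insert_self _ _)
    have h2 := h e₂ (Finset.mem_insert_of_mem (Finset.mem_insert_self _ _))
    simp only [h1, h2]
  rw [real_heavy_side_eq_sum D q ch hch G hGdisj hGch lv hlv a j u hGu hau _ hX1 hX2 _ hc]
  -- the four subsets
  have ha0 : Function.update a u 0 = a := Function.update_eq_self_iff.2 hau.symm
  rw [Finset.sum_powerset_insert he₁', Finset.sum_powerset_insert he₂', Finset.sum_powerset_insert he₂',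
    Finset.powerset_empty, Finset.sum_singleton, Finset.sum_singleton, Finset.sum_singleton, Finset.sum_singleton]
  simp only [Finset.prod_insert he₁', Finset.prod_insert he₂', Finset.prod_empty, Finset.mem_insert,
    Finset.notMem_empty, he, he.symm, Finset.coe_insert, Finset.coe_empty, Set.mem_insert_iff,
    Set.mem_empty_iff_false, if_true, if_false, or_false, or_true, and_true, and_false,
    and_self, Nat.add_zero, ha0]
  norm_num
  ring

/-- **FAR AT EVERY LAYER FOR A BLOCK-COMB WITH ONE TWO-RELAY HAIR (gate coordinates).**  Independent gates `q` on `E`; an injective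
chain `ch : Fin D → E`; blobs with pairwise disjoint private gate sets `G k` off the chain, levels `lv k ≤ D`, sizes `a k`; two spare
indices `u ≠ β` (`G u = ∅`, `a u = a β = 0`, `lv β = lv u`) book-keeping a HAIR at chain level `lv u`: a unit relay on the gate `e₁` and a
unit relay on the gate `e₂` below it (`e₁ ≠ e₂` off the chain and the blobs).  If `2j <` the mean
`Σ_k a k·(∏_{i<lv k} q (ch i))·∏_{G k} q + (∏_{i<lv u} q (ch i))·(q e₁ + q e₁ q e₂)`, every live blob and the hair's lower relay have
`1 − marginal ≤ t`, and the chain floor satisfies `1 − ∏_{i<D} q (ch i) ≤ t`, then `P(#relays reached ≤ j) ≤ t`.  (`real_heavy_hair_eq` +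
`Quant.BlockComb.tail_ge_of_mean_hair_le`, census-1 g13's mixture principle p248279.) [this work] -/
theorem farTree_blockComb_hair (q : E → unitInterval) (D : ℕ) (ch : Fin D → E) (hch : Function.Injective ch)
    (G : κ → Finset E) (hGdisj : ∀ k k', k ≠ k' → Disjoint (G k) (G k')) (hGch : ∀ k (i : Fin D), ch i ∉ G k)
    (lv : κ → ℕ) (hlv : ∀ k, lv k ≤ D) (a : κ → ℕ) (j : ℕ) (t : ℝ)
    (u β : κ) (huβ : u ≠ β) (hlβ : lv β = lv u) (hGu : G u = ∅) (hau : a u = 0) (haβ : a β = 0)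
    (e₁ e₂ : E) (he : e₁ ≠ e₂) (hch₁ : ∀ i : Fin D, ch i ≠ e₁) (hch₂ : ∀ i : Fin D, ch i ≠ e₂)
    (hG₁ : ∀ k, e₁ ∉ G k) (hG₂ : ∀ k, e₂ ∉ G k)
    (hbudget : (2 * j : ℝ) < ∑ k, (a k : ℝ) *
      ((∏ i ∈ Finset.range (lv k), (if h : i < D then ((q (ch ⟨i, h⟩) : unitInterval) : ℝ) else 1)) *
        ∏ e ∈ G k, (q e : ℝ)) +
      (∏ i ∈ Finset.range (lv u), (if h : i < D then ((q (ch ⟨i, h⟩) : unitInterval) : ℝ) else 1)) *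
        ((q e₁ : ℝ) + (q e₁ : ℝ) * (q e₂ : ℝ)))
    (ht : ∀ k, 0 < a k →
      1 - (∏ i ∈ Finset.range (lv k), (if h : i < D then ((q (ch ⟨i, h⟩) : unitInterval) : ℝ) else 1)) *
        ∏ e ∈ G k, (q e : ℝ) ≤ t)
    (hthair : 1 - (∏ i ∈ Finset.range (lv u), (if h : i < D then ((q (ch ⟨i, h⟩) : unitInterval) : ℝ) else 1)) *
        ((q e₁ : ℝ) * (q e₂ : ℝ)) ≤ t)
    (htD : 1 - (∏ i ∈ Finset.range D, (if h : i < D then ((q (ch ⟨i, h⟩) : unitInterval) : ℝ) else 1)) ≤ t) :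
    (prodBernoulli q).real {ω : Set E | (∑ k ∈ Finset.univ.filter
        (fun k => (∀ i : Fin D, (i : ℕ) < lv k → ch i ∈ ω) ∧ ((G k : Finset E) : Set E) ⊆ ω), a k) +
        (if (∀ i : Fin D, (i : ℕ) < lv u → ch i ∈ ω) ∧ e₁ ∈ ω then 1 else 0) +
        (if (∀ i : Fin D, (i : ℕ) < lv u → ch i ∈ ω) ∧ e₁ ∈ ω ∧ e₂ ∈ ω then 1 else 0) ≤ j} ≤ t := by
  -- trivial when `t ≥ 1`
  by_cases ht1 : 1 ≤ t
  · exact le_trans measureReal_le_one ht1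
  push Not at ht1
  set H : Set (Set E) := {ω : Set E | j + 1 ≤ (∑ k ∈ Finset.univ.filter
        (fun k => (∀ i : Fin D, (i : ℕ) < lv k → ch i ∈ ω) ∧ ((G k : Finset E) : Set E) ⊆ ω), a k) +
        (if (∀ i : Fin D, (i : ℕ) < lv u → ch i ∈ ω) then
          ((if e₁ ∈ ω then 1 else 0) + (if e₁ ∈ ω ∧ e₂ ∈ ω then 1 else 0)) else 0)} with hH
  have hcompl : {ω : Set E | (∑ k ∈ Finset.univ.filter
        (fun k => (∀ i : Fin D, (i : ℕ) < lv k → ch i ∈ ω) ∧ ((G k : Finset E) : Set E) ⊆ ω), a k) +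
        (if (∀ i : Fin D, (i : ℕ) < lv u → ch i ∈ ω) ∧ e₁ ∈ ω then 1 else 0) +
        (if (∀ i : Fin D, (i : ℕ) < lv u → ch i ∈ ω) ∧ e₁ ∈ ω ∧ e₂ ∈ ω then 1 else 0) ≤ j} = Hᶜ := by
    ext ω
    simp only [hH, Set.mem_setOf_eq, Set.mem_compl_iff, not_le]
    have aux : ((if (∀ i : Fin D, (i : ℕ) < lv u → ch i ∈ ω) ∧ e₁ ∈ ω then 1 else 0) +
        (if (∀ i : Fin D, (i : ℕ) < lv u → ch i ∈ ω) ∧ e₁ ∈ ω ∧ e₂ ∈ ω then 1 else 0) : ℕ) =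
        (if (∀ i : Fin D, (i : ℕ) < lv u → ch i ∈ ω) then
          ((if e₁ ∈ ω then 1 else 0) + (if e₁ ∈ ω ∧ e₂ ∈ ω then 1 else 0)) else 0) := by
      by_cases hp : ∀ i : Fin D, (i : ℕ) < lv u → ch i ∈ ω
      · rw [if_pos hp]
        by_cases h1 : e₁ ∈ ω
        · rw [if_pos (And.intro hp h1), if_pos h1]
          by_cases h2 : e₂ ∈ ω
          · rw [if_pos (And.intro hp (And.intro h1 h2)), if_pos (And.intro h1 h2)]
          · rw [if_neg (fun h => h2 h.2.2), if_neg (fun h => h2 h.2)]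
        · rw [if_neg (fun h => h1 h.2), if_neg (fun h => h1 h.2.1), if_neg h1, if_neg (fun h => h1 h.1)]
      · rw [if_neg (fun h => hp h.1), if_neg (fun h => hp h.1), if_neg hp]
    rw [add_assoc, aux]
    omega
  rw [hcompl, probReal_compl_eq_one_sub MeasurableSet.of_discrete,
    real_heavy_hair_eq D q ch hch G hGdisj hGch lv hlv a j u hGu hau e₁ e₂ he hch₁ hch₂ hG₁ hG₂]
  -- the canonical theorem
  set qc : ℕ → ℝ := fun i => if h : i < D then ((q (ch ⟨i, h⟩) : unitInterval) : ℝ) else 1 with hqc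
  set g : κ → ℝ := fun k => ∏ e ∈ G k, (q e : ℝ) with hg
  have hqc01 : ∀ i, 0 ≤ qc i ∧ qc i ≤ 1 := fun i => by
    by_cases h : i < D
    · simp only [hqc, dif_pos h]; exact ⟨(q _).2.1, (q _).2.2⟩
    · simp only [hqc, dif_neg h]; norm_num
  have hg01 : ∀ k, 0 ≤ g k ∧ g k ≤ 1 := fun k =>
    ⟨Finset.prod_nonneg fun e _ => (q e).2.1, Finset.prod_le_one (fun e _ => (q e).2.1) fun e _ => (q e).2.2⟩
  have hg1 : Function.update g u 1 = g := Function.update_eq_self_iff.2 (by simp only [hg, hGu, Finset.prod_empty])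
  have hx : ∀ k, 0 < a k → 1 - t ≤ (∏ i ∈ Finset.range (lv k), qc i) * g k := fun k hk => by have := ht k hk; linarith
  have hxD : 1 - t ≤ ∏ i ∈ Finset.range D, qc i := by linarith
  have hhair' : 1 - t ≤ (∏ i ∈ Finset.range (lv u), qc i) * ((q e₁ : ℝ) * (q e₂ : ℝ)) := by linarith
  have key := BlockComb.tail_ge_of_mean_hair_le D qc hqc01 lv a g hg01 j (fun k _ => hlv k) u β huβ (hlv u) hlβ hau haβ
    (q e₁ : ℝ) (q e₂ : ℝ) ⟨(q e₁).2.1, (q e₁).2.2⟩ ⟨(q e₂).2.1, (q e₂).2.2⟩ (1 - t) (by linarith) hxD hx hhair' hbudget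
  rw [hg1] at key
  linarith

end BlockCombGate

end Quant

end Summit.CriticalPhenomena.PercolationContinuityZ3.Theorems

end
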